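import Literature.Computability.AlgebraicComplexity.AsymptoticSpectrumDuality
import Summits.MatrixMultiplication.MatrixMultiplication.Theorems.SoloInformedCwTwoPlusUnitUniversal

/-!
# The host value in Theorem V is exact: `R̃(T_{cw,2} ⊕ ⟨1⟩) = R̃(T_{cw,2}) + 1`

Solo seat `solo-MatrixMultiplication-informed` (gen 21), a footnote to
`SoloInformedCwTwoPlusUnitUniversal` (Theorem V: every `T ∈ ℂ³ ⊗ ℂ³ ⊗ ℂ³` satisfies
`R̃(T) ≤ R̃(U)`, `U = T_{cw,2} ⊕ ⟨1⟩ = univTensor`). By Strassen duality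
(`strassen_duality_asymptoticRank_holds`, proved in the tree) the asymptotic rank is the maximum of
the universal spectral points, which are additive under `⊕` and normalised by `F(⟨1⟩) = 1`; hence
`R̃(s ⊕ ⟨1⟩) = R̃(s) + 1` for every tensor `s` (`asymptoticRank_directSum_unitTensor_one`) and in
particular `R̃(U) = R̃(T_{cw,2}) + 1` exactly (`asymptoticRank_univTensor_eq`). So the universal bound
of Theorem V is the host's own asymptotic rank, `max_{3×3×3} R̃ ≤ R̃(U) = R̃(T_{cw,2}) + 1`
(`asymptoticRank_le_univTensor_eq`): improving the "+1" requires a different host (the restriction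
submersion cannot do better with `U`), and under door D1 the host has `R̃(U) = 4` on the nose
(`asymptoticRank_univTensor_eq_four_of_door`).

References: V. Strassen, J. reine angew. Math. 384 (1988) 102–152, Thm. 3.8; M. Christandl,
P. Vrana, J. Zuiddam, J. Amer. Math. Soc. 36 (2023), Prop. 1.6.
-/

namespace Summit.MatrixMultiplication.MatrixMultiplication.Theorems.CwTwoPlusUnit

open Literature.Computability.AlgebraicComplexity

/-- **`R̃(s ⊕ ⟨1⟩) = R̃(s) + 1`** for every 3-tensor `s` over `ℂ`: `≤` is sub-additivity plus
`R̃(⟨1⟩) ≤ 1`; `≥` evaluates a universal spectral point `F` with `F(s) = R̃(s)` (duality, attained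
maximum) on `s ⊕ ⟨1⟩`, where `F(s ⊕ ⟨1⟩) = F(s) + 1 ≤ R̃(s ⊕ ⟨1⟩)`. [cite: ChristandlVranaZuiddam2023, Prop. 1.6] -/
theorem asymptoticRank_directSum_unitTensor_one {ι κ μ : Type} [Fintype ι] [Fintype κ] [Fintype μ]
    (s : ι → κ → μ → ℂ) :
    asymptoticRank (directSumTensor s (unitTensor ℂ 1)) = asymptoticRank s + 1 := by
  refine le_antisymm ((asymptoticRank_directSumTensor_le _ _).trans
    (by simpa using add_le_add_left (asymptoticRank_unitTensor_le ℂ 1) (asymptoticRank s))) ?_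
  obtain ⟨F, hF, hFs⟩ := (strassen_duality_asymptoticRank_holds ℂ s).2
  have h := (strassen_duality_asymptoticRank_holds ℂ (directSumTensor s (unitTensor ℂ 1))).1 F hF
  rwa [hF.map_directSum, hF.map_unitTensor_one, hFs] at h

/-- **`R̃(T_{cw,2} ⊕ ⟨1⟩) = R̃(T_{cw,2}) + 1`**: the host of Theorem V has asymptotic rank exactly
one more than the small Coppersmith–Winograd tensor. [cite: ChristandlVranaZuiddam2023, Prop. 1.6] -/
theorem asymptoticRank_univTensor_eq :
    asymptoticRank univTensor = asymptoticRank (cwTensor ℂ 2) + 1 :=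
  asymptoticRank_directSum_unitTensor_one _

/-- **Theorem V with the host value pinned**: every `T ∈ ℂ³ ⊗ ℂ³ ⊗ ℂ³` has
`R̃(T) ≤ R̃(T_{cw,2} ⊕ ⟨1⟩) = R̃(T_{cw,2}) + 1` — the universal bound *is* the host's asymptotic
rank, so a bound below `R̃(T_{cw,2}) + 1` needs a different host. [new] -/
theorem asymptoticRank_le_univTensor_eq (T : Fin 3 → Fin 3 → Fin 3 → ℂ) :
    asymptoticRank T ≤ asymptoticRank univTensor ∧
      asymptoticRank univTensor = asymptoticRank (cwTensor ℂ 2) + 1 :=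
  ⟨asymptoticRank_le_univTensor T, asymptoticRank_univTensor_eq⟩

/-- **Under door D1 the host has `R̃(U) = 4` exactly** (`R̃(T_{cw,2}) ≥ 3` is the flattening
bound, in the tree via `SoloInformedCwTwoDoor`/`Speedup`; here only `R̃(T_{cw,2}) = 3 ⇒ R̃(U) = 4`
is recorded). [new] -/
theorem asymptoticRank_univTensor_eq_four_of_door (h : asymptoticRank (cwTensor ℂ 2) = 3) :
    asymptoticRank univTensor = 4 := by
  rw [asymptoticRank_univTensor_eq, h]; norm_num

end Summit.MatrixMultiplication.MatrixMultiplication.Theorems.CwTwoPlusUnit
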